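import Summits.QuantumFields.YangMills.Theorems.SwapVirialDeficitBlowUpGnomonicFibreDefs
import Summits.QuantumFields.YangMills.Theorems.SwapVirialDeficitBlowUpGnomonicBaseFlat
import Summits.QuantumFields.YangMills.Theorems.SwapVirialDeficitBlowUpGnoDensityAmplitude
import Summits.QuantumFields.YangMills.Theorems.SwapVirialDeficitQuantitativeLaplaceCubicDatum
import Summits.QuantumFields.YangMills.Theorems.SwapVirialDeficitQuantitativeLaplaceFibrePackage
import HarnessLib

/-!
# W3-pack, part 2: THE HESSIAN-OPERATOR PACKAGE OF THE GNOMONIC FIBRE on the Euclidean fibre `V_L = GnoFibre L`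
# (free-hands support of ⟨stmt-QuantumFields-24197⟩ `SwapVirialDeficit.SwapGluedStiffness`; the `hA ∕ hcoer ∕ hAm ∕ hf ∕ hρ ∕ hw ∕ hchart` sockets of
# ✓`QuantitativeLaplace.laplaceMethod_quantitative_fibred_chart_cubic_offBound_on` INSTANTIATED ON THE MODEL, principal sector; w3 g65's successor items (a)+(b))

Everything generic is w2 g58's (ns `…QuantitativeLaplace`: ✓`exists_hessianOperator`, ✓`iteratedFDeriv_two_eq_lineJet`, ✓`third_bound_of_lineJet`, ✓`cubicDatum_of_third`,
✓`measurable_inner_of_eq_fibreHessianForm`); everything model-side is fcl-p3 g47's jets ✓`taylor_four_gnoDeficit_line` (read with letter size `S = ‖y‖`,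
✓`letterSizes_gnoFibreEmb_le`), w3 g65's coercivity ✓`fibre_raySecond_coercive_gnomonic` in w3 g66's unconditional form ✓`fibre_raySecond_coercive_gnomonic_flat`, w3 g66's
flatness ✓`gnoDeficit_base_comp_zero` ∕ ✓`fderiv_gnoDeficit_base_comp_eq_zero`, and w3 g65's amplitude ✓`gnoDensity_amplitude`.  This file only TRANSLATES them into the
letters `(p, y) ∈ (ℝ × ℝ) × V_L` of ✓`gnoFibreEquiv`:

* §1 rays and jets on `V_L`: `contDiff_gnoDeficit_fibreChart` (`(η, y) ↦ F̂(η + gnoFibreEmb y)` is `C^n`), `gnoDeficit_fibre_ray` (rays of the fibre restriction are gnomonic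
  lines), ★ `fibre_lineJets` (g47's four jet bounds and two Taylor remainders along `s ↦ F̂(η + s·gnoFibreEmb y)` with `S = ‖y‖`), ★ `fibre_third_bound` ∕ `fibre_second_bound`
  (`|D³_y F̂(η + ·)(z₀)[u,u,u]| ≤ 2484000L⁴‖u‖³`, `|D²…[u,u]| ≤ 20400L⁴‖u‖²` at EVERY fibre point);
* §2 ★★★ `exists_gnoFibreHessian (z χ) (ha) (ε)` — a family `A : GnoCoord L → V_L →ₗ[ℝ] V_L` of SYMMETRIC operators indexed by the expansion point `η`, with
  `⟪A η y, w⟫ = D²_y(F̂(η + gnoFibreEmb ·))(0)[y][w]`, the RAY identity `⟪A η y, y⟫ = (d²/ds²) F̂(η + s·gnoFibreEmb y)|₀`, joint MEASURABILITY of `(η, y) ↦ ⟪A η y, y⟫`,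
  the bound `|⟪A η y, y⟫| ≤ 20400L⁴‖y‖²`, and the order-2 Taylor remainder `|F̂(η + gnoFibreEmb y) − F̂ η − ψ′(0) − ½⟪A η y, y⟫| ≤ 1242000L⁴‖y‖³` (every sector, every `η`);
* §3 principal sector at the FLAT BASE `gnoBase x₀ y₀` (signs `ε_z = +`, followers `+`): ★★ `gnoFibreHessian_base_coercive` (`μ′‖y‖² ≤ ⟪A (gnoBase x₀ y₀) y, y⟫` for every
  `0 < μ′ ≤` the four growth constants — w3's coercivity through ✓`norm_sq_gnoFibre` ∕ ✓`gnoFibreEmb_eq_fibreDir`), ★★ `gnoFibreHessian_base_cubic`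
  (`|F̂(gnoBase x₀ y₀ + gnoFibreEmb y) − ½⟪A (gnoBase x₀ y₀) y, y⟫| ≤ 414000L⁴‖y‖³`, all `y`: ✓`cubicDatum_of_third`);
* §4 the amplitude and the chart in `(p, y)` letters: `eulerDilate_zero_gnoFibreEquiv` (`= gnoBase`), `fibreSq_gnoFibreEquiv` (`Q_fib = ‖y‖²`), ★ `gnoDensity_fibre_amplitude`
  (`gnoDensity (gnoFibreEquiv (p,y)) = gnoDensity (gnoBase p) · (1 + e)` with `−2‖y‖² ≤ e ≤ 0`), ★ `volume_gnoDensity_restrict_tube_eq_map` (the tube `hchart` over any measurable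
  base set `S`);
* §5 ★★★ `gnoFibre_bulk_sockets` — ONE existential packaging `A p := A (gnoBase p)`, `ρ`, `e` with: symmetry, measurability of `⟪A p y, y⟫`, of `ρ` and of `e`; the ray identity;
  `F̂(gnoFibreEquiv (p, y)) − 0 = ½⟪A p y, y⟫ + ρ(p, y)` with `|ρ| ≤ 414000L⁴‖y‖³`; `gnoDensity(gnoFibreEquiv (p,y))·1 = gnoDensity(gnoBase p)·(1 + e(p,y))` with
  `|e| ≤ 2R‖y‖` on `‖y‖ ≤ R`; `|⟪A p y, y⟫| ≤ 20400L⁴‖y‖²`; and the coercivity clause at every base point — literally the `hA hAm hρ_meas hη_meas hf hρ hw hcoer` of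
  ✓`laplaceMethod_quantitative_fibred_chart_cubic_offBound_on` with `X := GnoCoord L`, `μ := vol·gnoDensity`, `M := ℝ × ℝ`, `V := V_L`, `Ψ := gnoFibreEquiv`, `f := F̂`, `f₀ := 0`,
  `A₃ := 414000L⁴`, `D := 2R`, `J := gnoDensity ∘ gnoFibreEquiv`, `φ := 1` on the cylinder.

What is NOT here: the choice of the bulk base set and of `μ′(ψ₀(b))` (LEAD 17:34Z ruling: one cut `ψ₀(b) = b^{−σ}`), the off-tube bound (w3's ✓`fibre_offTube_floor_gnomonic` +
✓`exists_of_mem_cylinder_not_mem_tube` + ✓`offTube_bound_of_cylinder`), the hub integral and its joint measurability in `a` (w3 g66), the tip, sector `001`.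
HONEST LABEL: packaging of landed results; ⟨24197⟩ ∕ ⟨24194⟩ (window-uniform) OPEN; own crux ⟨22884⟩ OPEN (blocked-on ⟨19935⟩); no crux, rung of record or summit is proved;
the Yang–Mills mass gap is NOT proved; no summit is proved by a line.  Width seat ym-line-sfw-p2-w2 g59 (cell ym-idea-1, free hands), `--supports stmt-QuantumFields-24197`.
THEOREMS ONLY (0 `def`, 0 `sorry`), standard axioms.  References: [cite: Luscher1983, §2]; [cite: HasenpflugRudolfSprungk2024, §3.1 Assumption 2]; [folklore].
-/

set_option autoImplicit false
set_option synthInstance.maxSize 1024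

noncomputable section

open MeasureTheory Quaternion Set Metric
open scoped BigOperators Quaternion ContDiff InnerProductSpace ENNReal
open Literature.MathematicalPhysics.QuantumFieldTheory hiding SU2
open Literature.MathematicalPhysics.QuantumLattice

namespace Summit.QuantumFields.YangMills.Theorems.SwapVirialDeficit.BlowUpRing

open Summit.QuantumFields.YangMills.Theorems.FemtoTransferGap
open Summit.QuantumFields.YangMills.Theorems.FemtoTransferGap.TT
open Summit.QuantumFields.YangMills.Theorems.VirialFluxGap.RingDeficit
open Summit.QuantumFields.YangMills.Theorems.SwapVirialDeficit.SwapRing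
open Summit.QuantumFields.YangMills.Theorems.SwapVirialDeficit.Gnomonic (normSq3 normSq3_nonneg taylor_four_gnoDeficit_line contDiff_gnoDeficit)
open Summit.QuantumFields.YangMills.Theorems.QuantitativeLaplace (exists_hessianOperator iteratedFDeriv_two_eq_lineJet third_bound_of_lineJet cubicDatum_of_third
  measurable_inner_of_eq_fibreHessianForm)

variable {L : ℕ} [NeZero L]

/-! ## §1 Rays and jets of the fibre restriction -/

/-- `(η, y) ↦ F̂(η + gnoFibreEmb y)` is `C^n` jointly (✓`contDiff_gnoDeficit` ∘ affine). [cite: Luscher1983, §2] -/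
theorem contDiff_gnoDeficit_fibreChart (z : Fin 3 → Bool) (χ : Site 3 L → SU2) {a : ℍ} (ha : a ≠ 0) (ε : GnoSign L) {n : ℕ∞} :
    ContDiff ℝ n fun q : GnoCoord L × GnoFibre L => gnoDeficit z χ a ε (q.1 + gnoFibreEmb q.2) :=
  (contDiff_gnoDeficit (n := n) z χ ha ε).comp (contDiff_fst.add ((gnoFibreEmb (L := L)).contDiff.comp contDiff_snd))

/-- `y ↦ F̂(η + gnoFibreEmb y)` is `C^n` for every expansion point `η`. [cite: Luscher1983, §2] -/
theorem contDiff_gnoDeficit_fibre (z : Fin 3 → Bool) (χ : Site 3 L → SU2) {a : ℍ} (ha : a ≠ 0) (ε : GnoSign L) (η : GnoCoord L) {n : ℕ∞} :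
    ContDiff ℝ n fun y : GnoFibre L => gnoDeficit z χ a ε (η + gnoFibreEmb y) :=
  (contDiff_gnoDeficit (n := n) z χ ha ε).comp (contDiff_const.add (gnoFibreEmb (L := L)).contDiff)

/-- Rays of the fibre restriction are gnomonic lines: `F̂(η + gnoFibreEmb (z₀ + s·y)) = F̂((η + gnoFibreEmb z₀) + s·gnoFibreEmb y)`. [folklore] -/
theorem gnoDeficit_fibre_ray (z : Fin 3 → Bool) (χ : Site 3 L → SU2) (a : ℍ) (ε : GnoSign L) (η : GnoCoord L) (z₀ y : GnoFibre L) :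
    (fun s : ℝ => gnoDeficit z χ a ε (η + gnoFibreEmb (z₀ + s • y))) = fun s : ℝ => gnoDeficit z χ a ε ((η + gnoFibreEmb z₀) + s • gnoFibreEmb y) := by
  funext s; rw [map_add, map_smul, add_assoc]

/-- ★ **g47's LINE JETS along a fibre ray, letter size `S = ‖y‖`**: with `ψ s = F̂(η + s·gnoFibreEmb y)`: `|ψ′| ≤ 720L⁴‖y‖`, `|ψ″| ≤ 20400L⁴‖y‖²`, `|ψ‴| ≤ 2484000L⁴‖y‖³`,
`|ψ⁗| ≤ 381240000L⁴‖y‖⁴` everywhere, and the order-2 ∕ order-3 Taylor remainders at `s = 0`. [cite: Luscher1983, §2] -/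
theorem fibre_lineJets (z : Fin 3 → Bool) (χ : Site 3 L → SU2) {a : ℍ} (ha : a ≠ 0) (ε : GnoSign L) (η : GnoCoord L) (y : GnoFibre L) :
    (∀ s, |deriv (fun s : ℝ => gnoDeficit z χ a ε (η + s • gnoFibreEmb y)) s| ≤ 720 * (L : ℝ) ^ 4 * ‖y‖ ∧
        |iteratedDeriv 2 (fun s : ℝ => gnoDeficit z χ a ε (η + s • gnoFibreEmb y)) s| ≤ 20400 * (L : ℝ) ^ 4 * ‖y‖ ^ 2 ∧
        |iteratedDeriv 3 (fun s : ℝ => gnoDeficit z χ a ε (η + s • gnoFibreEmb y)) s| ≤ 2484000 * (L : ℝ) ^ 4 * ‖y‖ ^ 3 ∧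
        |iteratedDeriv 4 (fun s : ℝ => gnoDeficit z χ a ε (η + s • gnoFibreEmb y)) s| ≤ 381240000 * (L : ℝ) ^ 4 * ‖y‖ ^ 4) ∧
      |gnoDeficit z χ a ε (η + gnoFibreEmb y) - gnoDeficit z χ a ε η - deriv (fun s : ℝ => gnoDeficit z χ a ε (η + s • gnoFibreEmb y)) 0 -
          iteratedDeriv 2 (fun s : ℝ => gnoDeficit z χ a ε (η + s • gnoFibreEmb y)) 0 / 2| ≤ 2484000 * (L : ℝ) ^ 4 * ‖y‖ ^ 3 / 2 ∧
      |gnoDeficit z χ a ε (η + gnoFibreEmb y) - gnoDeficit z χ a ε η - deriv (fun s : ℝ => gnoDeficit z χ a ε (η + s • gnoFibreEmb y)) 0 -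
          iteratedDeriv 2 (fun s : ℝ => gnoDeficit z χ a ε (η + s • gnoFibreEmb y)) 0 / 2 - iteratedDeriv 3 (fun s : ℝ => gnoDeficit z χ a ε (η + s • gnoFibreEmb y)) 0 / 6| ≤
        381240000 * (L : ℝ) ^ 4 * ‖y‖ ^ 4 / 6 := by
  obtain ⟨hx, hy, hz, hf⟩ := letterSizes_gnoFibreEmb_le (L := L) y
  exact taylor_four_gnoDeficit_line z χ ha ε η (gnoFibreEmb y) (norm_nonneg y) hx hy hz hf

/-- ★ **THE DIRECTIONAL THIRD DERIVATIVE ON THE WHOLE FIBRE**: `|D³_y (F̂(η + gnoFibreEmb ·))(z₀)[u,u,u]| ≤ 2484000L⁴‖u‖³` at EVERY fibre point `z₀` (✓`third_bound_of_lineJet`;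
the `h3` of ✓`cubicDatum_of_third`, the `M₃` of ✓`form_floor_of_third_directional` ∕ ✓`abs_hessianForm_sub_le_of_third`). [cite: Luscher1983, §2] -/
theorem fibre_third_bound (z : Fin 3 → Bool) (χ : Site 3 L → SU2) {a : ℍ} (ha : a ≠ 0) (ε : GnoSign L) (η : GnoCoord L) (z₀ u : GnoFibre L) :
    |iteratedFDeriv ℝ 3 (fun y : GnoFibre L => gnoDeficit z χ a ε (η + gnoFibreEmb y)) z₀ (fun _ => u)| ≤ 2484000 * (L : ℝ) ^ 4 * ‖u‖ ^ 3 := by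
  refine third_bound_of_lineJet (S := univ) (contDiff_gnoDeficit_fibre (n := 3) z χ ha ε η) (fun z₁ _ ξ => ?_) z₀ (mem_univ _) u
  rw [gnoDeficit_fibre_ray]
  exact ((fibre_lineJets z χ ha ε (η + gnoFibreEmb z₁) ξ).1 0).2.2.1

/-- ★ **THE DIRECTIONAL SECOND DERIVATIVE ON THE WHOLE FIBRE**: `|D²_y (F̂(η + gnoFibreEmb ·))(z₀)[u,u]| ≤ 20400L⁴‖u‖²`. [cite: Luscher1983, §2] -/
theorem fibre_second_bound (z : Fin 3 → Bool) (χ : Site 3 L → SU2) {a : ℍ} (ha : a ≠ 0) (ε : GnoSign L) (η : GnoCoord L) (z₀ u : GnoFibre L) :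
    |iteratedFDeriv ℝ 2 (fun y : GnoFibre L => gnoDeficit z χ a ε (η + gnoFibreEmb y)) z₀ (fun _ => u)| ≤ 20400 * (L : ℝ) ^ 4 * ‖u‖ ^ 2 := by
  rw [iteratedFDeriv_two_eq_lineJet (contDiff_gnoDeficit_fibre (n := 2) z χ ha ε η) z₀ u, gnoDeficit_fibre_ray]
  exact ((fibre_lineJets z χ ha ε (η + gnoFibreEmb z₀) u).1 0).2.1

/-! ## §2 The Hessian operator family -/

/-- ★★★ **THE HESSIAN OPERATORS OF THE GNOMONIC FIBRE.**  For every sector `z`, character `χ`, hub `a ≠ 0` and signs `ε` there is a family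
`A : GnoCoord L → V_L →ₗ[ℝ] V_L` (indexed by the expansion point `η`) of SYMMETRIC operators with: the bilinear identity `⟪A η y, w⟫ = D(D(F̂(η + gnoFibreEmb ·)))(0)[y][w]`,
the form identity, the RAY identity `⟪A η y, y⟫ = (d²/ds²) F̂(η + s·gnoFibreEmb y)|₀` (so w3's ray statements read on `A`), the joint MEASURABILITY of `(η, y) ↦ ⟪A η y, y⟫`,
the bound `|⟪A η y, y⟫| ≤ 20400L⁴‖y‖²`, and the order-2 Taylor remainder `|F̂(η + gnoFibreEmb y) − F̂ η − ψ′(0) − ½⟪A η y, y⟫| ≤ 1242000L⁴‖y‖³` at EVERY `η`.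
[cite: Luscher1983, §2] [cite: HasenpflugRudolfSprungk2024, §3.1 Assumption 2] -/
theorem exists_gnoFibreHessian (z : Fin 3 → Bool) (χ : Site 3 L → SU2) {a : ℍ} (ha : a ≠ 0) (ε : GnoSign L) :
    ∃ A : GnoCoord L → GnoFibre L →ₗ[ℝ] GnoFibre L,
      (∀ η, (A η).IsSymmetric) ∧
      (∀ η (y w : GnoFibre L), ⟪A η y, w⟫_ℝ = fderiv ℝ (fderiv ℝ (fun y' : GnoFibre L => gnoDeficit z χ a ε (η + gnoFibreEmb y'))) 0 y w) ∧
      (∀ η (y : GnoFibre L), ⟪A η y, y⟫_ℝ = iteratedFDeriv ℝ 2 (fun y' : GnoFibre L => gnoDeficit z χ a ε (η + gnoFibreEmb y')) 0 (fun _ => y)) ∧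
      (∀ η (y : GnoFibre L), ⟪A η y, y⟫_ℝ = iteratedDeriv 2 (fun s : ℝ => gnoDeficit z χ a ε (η + s • gnoFibreEmb y)) 0) ∧
      (Measurable fun q : GnoCoord L × GnoFibre L => ⟪A q.1 q.2, q.2⟫_ℝ) ∧
      (∀ η (y : GnoFibre L), |⟪A η y, y⟫_ℝ| ≤ 20400 * (L : ℝ) ^ 4 * ‖y‖ ^ 2) ∧
      (∀ η (y : GnoFibre L), |gnoDeficit z χ a ε (η + gnoFibreEmb y) - gnoDeficit z χ a ε η - deriv (fun s : ℝ => gnoDeficit z χ a ε (η + s • gnoFibreEmb y)) 0 -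
          (1 / 2) * ⟪A η y, y⟫_ℝ| ≤ 1242000 * (L : ℝ) ^ 4 * ‖y‖ ^ 3) := by
  have h2 : (2 : WithTop ℕ∞) ≤ 2 := le_rfl
  have hex := fun η : GnoCoord L => exists_hessianOperator ((contDiff_gnoDeficit_fibre (n := 2) z χ ha ε η).contDiffAt (x := (0 : GnoFibre L))) h2
  choose A hAs hAyw hAyy using hex
  -- the ray identity
  have hray : ∀ η (y : GnoFibre L), ⟪A η y, y⟫_ℝ = iteratedDeriv 2 (fun s : ℝ => gnoDeficit z χ a ε (η + s • gnoFibreEmb y)) 0 := fun η y => by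
    rw [hAyy, iteratedFDeriv_two_eq_lineJet (contDiff_gnoDeficit_fibre (n := 2) z χ ha ε η) 0 y, gnoDeficit_fibre_ray, map_zero, add_zero]
  refine ⟨A, hAs, hAyw, hAyy, hray, ?_, fun η y => ?_, fun η y => ?_⟩
  · -- measurability: the Hessian form of the jointly smooth `G (η, y) = F̂(η + gnoFibreEmb y)` along `ι = id`, `y⋆ = 0`
    have h2' : (2 : WithTop ℕ∞) ≤ ((2 : ℕ∞) : WithTop ℕ∞) := le_rfl
    exact measurable_inner_of_eq_fibreHessianForm (G := fun q : GnoCoord L × GnoFibre L => gnoDeficit z χ a ε (q.1 + gnoFibreEmb q.2))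
      (contDiff_gnoDeficit_fibreChart (n := 2) z χ ha ε) h2' (M := GnoCoord L) (ι := id) continuous_id (ys := fun _ => (0 : GnoFibre L)) continuous_const
      (A := fun η y => A η y) (B := fun _ y => y) (fun η y => hAyy η y)
  · rw [hray]; exact ((fibre_lineJets z χ ha ε η y).1 0).2.1
  · have h := (fibre_lineJets z χ ha ε η y).2.1
    rw [hray]
    have e : (1 / 2 : ℝ) * iteratedDeriv 2 (fun s : ℝ => gnoDeficit z χ a ε (η + s • gnoFibreEmb y)) 0 =
        iteratedDeriv 2 (fun s : ℝ => gnoDeficit z χ a ε (η + s • gnoFibreEmb y)) 0 / 2 := by ring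
    rw [e]
    refine h.trans (le_of_eq ?_)
    ring

/-! ## §3 Principal sector at the flat base: coercivity and the cubic datum -/

/-- ★★ **COERCIVITY AT THE FLAT BASE, ON `V_L`**: for a hub `a ≠ 0`, signs `ε_z = +` and followers `+`, every `x₀ y₀`, every `0 < μ′` below w3 g65's four growth constants
and EVERY `y : V_L`: `μ′‖y‖² ≤ ⟪A (gnoBase x₀ y₀) y, y⟫` — for any operator family `A` with the ray identity (✓`fibre_raySecond_coercive_gnomonic_flat` read through
✓`gnoFibreEmb_eq_fibreDir` and ✓`norm_sq_gnoFibre`). [cite: Luscher1983, §2] -/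
theorem gnoFibreHessian_base_coercive {a : ℍ} (ha : a ≠ 0) (ε : GnoSign L) (hz : ε.2.1 = true) (hε : ε.2.2 = fun _ => true)
    {A : GnoCoord L → GnoFibre L →ₗ[ℝ] GnoFibre L}
    (hray : ∀ η (y : GnoFibre L), ⟪A η y, y⟫_ℝ = iteratedDeriv 2 (fun s : ℝ => gnoDeficit (fun _ => false) (fun _ => 1) a ε (η + s • gnoFibreEmb y)) 0)
    (x₀ y₀ : ℝ) {μ' : ℝ} (hμ : 0 < μ')
    (hμx : μ' ≤ 2 * (2 * (‖a‖⁻¹ * a.re) * (‖a‖⁻¹ * ‖a.im‖)) ^ 2 / ((2 + x₀ ^ 2) * (16200 * (L : ℝ) ^ 6)))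
    (hμy : μ' ≤ 2 * (‖a‖⁻¹ * ‖a.im‖) ^ 2 / ((2 + y₀ ^ 2) * (16200 * (L : ℝ) ^ 6)))
    (hμz : μ' ≤ 1 / (16200 * (L : ℝ) ^ 6))
    (hμF : μ' ≤ (2304 * (L : ℝ) ^ 6 * (Fintype.card (Fol L) : ℝ))⁻¹ / 2) (y : GnoFibre L) :
    μ' * ‖y‖ ^ 2 ≤ ⟪A (gnoBase x₀ y₀) y, y⟫_ℝ := by
  rw [hray, norm_sq_gnoFibre, gnoFibreEmb_eq_fibreDir]
  exact fibre_raySecond_coercive_gnomonic_flat ha ε hz hε x₀ y₀ hμ hμx hμy hμz hμF (gnoFibreBlocks y)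

/-- ★★ **THE CUBIC DATUM AT THE FLAT BASE**: `|F̂(gnoBase x₀ y₀ + gnoFibreEmb y) − ½⟪A (gnoBase x₀ y₀) y, y⟫| ≤ 414000L⁴‖y‖³` for EVERY `y` (no radius) — ✓`cubicDatum_of_third` with
`hg0` ∕ `hg1` from w3 g66's ✓`gnoDeficit_base_comp_zero` ∕ ✓`fderiv_gnoDeficit_base_comp_eq_zero` (`T := gnoFibreEmb`) and `h3` = ✓`fibre_third_bound`. [cite: Luscher1983, §2] -/
theorem gnoFibreHessian_base_cubic {a : ℍ} (ha : a ≠ 0) (ε : GnoSign L) (hz : ε.2.1 = true) (hε : ε.2.2 = fun _ => true)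
    {A : GnoCoord L → GnoFibre L →ₗ[ℝ] GnoFibre L}
    (hAyy : ∀ η (y : GnoFibre L), ⟪A η y, y⟫_ℝ = iteratedFDeriv ℝ 2 (fun y' : GnoFibre L => gnoDeficit (fun _ => false) (fun _ => 1) a ε (η + gnoFibreEmb y')) 0 (fun _ => y))
    (x₀ y₀ : ℝ) (y : GnoFibre L) :
    |gnoDeficit (fun _ => false) (fun _ => 1) a ε (gnoBase x₀ y₀ + gnoFibreEmb y) - (1 / 2) * ⟪A (gnoBase x₀ y₀) y, y⟫_ℝ| ≤ 414000 * (L : ℝ) ^ 4 * ‖y‖ ^ 3 := by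
  have hg0 : gnoDeficit (fun _ => false) (fun _ => 1) a ε (gnoBase x₀ y₀ + gnoFibreEmb (0 : GnoFibre L)) = 0 :=
    gnoDeficit_base_comp_zero ha ε hz hε x₀ y₀ (gnoFibreEmb (L := L)) (map_zero _)
  have hg1 : fderiv ℝ (fun y' : GnoFibre L => gnoDeficit (fun _ => false) (fun _ => 1) a ε (gnoBase x₀ y₀ + gnoFibreEmb y')) 0 = 0 :=
    fderiv_gnoDeficit_base_comp_eq_zero ha ε hz hε x₀ y₀ (gnoFibreEmb (L := L)) (map_zero _)
  have h := cubicDatum_of_third (R := ‖y‖) (A₃ := 2484000 * (L : ℝ) ^ 4) (contDiff_gnoDeficit_fibre (n := 3) _ _ ha ε (gnoBase x₀ y₀)) hg0 hg1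
    (fun z₀ _ u => fibre_third_bound _ _ ha ε (gnoBase x₀ y₀) z₀ u) y le_rfl
  rw [← hAyy] at h
  refine h.trans (le_of_eq ?_)
  ring

/-! ## §4 The amplitude and the chart in `(p, y)` letters -/

/-- The base projection of the chart point is the base point: `eulerDilate 0 (gnoFibreEquiv (p, y)) = gnoBase p.1 p.2`. [folklore] -/
theorem eulerDilate_zero_gnoFibreEquiv (p : ℝ × ℝ) (y : GnoFibre L) : eulerDilate 0 (gnoFibreEquiv (p, y)) = gnoBase p.1 p.2 := by
  rw [gnoFibreEquiv_apply', gnoBase]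
  simp only [eulerDilate, zero_smul, trDil, Matrix.cons_val_zero, zero_mul]
  rfl

/-- The fibre gauge of the chart point is `‖y‖²`. [folklore] -/
theorem fibreSq_gnoFibreEquiv (p : ℝ × ℝ) (y : GnoFibre L) :
    (gnoFibreEquiv (p, y)).1.1 1 ^ 2 + (gnoFibreEquiv (p, y)).1.1 2 ^ 2 + ((gnoFibreEquiv (p, y)).1.2 1 ^ 2 + (gnoFibreEquiv (p, y)).1.2 2 ^ 2) +
        normSq3 (gnoFibreEquiv (p, y)).2.1 + ∑ f, normSq3 ((gnoFibreEquiv (p, y)).2.2 f) = ‖y‖ ^ 2 := by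
  rw [norm_sq_gnoFibre, gnoFibreEquiv_apply']
  simp only [gnoFibreBlocks, Matrix.cons_val_one, Matrix.cons_val_two, Matrix.head_cons, Matrix.tail_cons]
  rfl

/-- ★ **THE AMPLITUDE DATUM IN `(p, y)` LETTERS**: `gnoDensity (gnoFibreEquiv (p, y)) = gnoDensity (gnoBase p) · (1 + e)` with `−2‖y‖² ≤ e ≤ 0` (w3 g65's ✓`gnoDensity_amplitude`).
[folklore] -/
theorem gnoDensity_fibre_amplitude (p : ℝ × ℝ) (y : GnoFibre L) :
    ∃ e : ℝ, gnoDensity (gnoFibreEquiv (p, y)) = gnoDensity (gnoBase p.1 p.2 : GnoCoord L) * (1 + e) ∧ -(2 * ‖y‖ ^ 2) ≤ e ∧ e ≤ 0 := by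
  obtain ⟨e, he, h1, h2⟩ := exists_gnoDensity_eq_mul_one_add (gnoFibreEquiv (p, y))
  rw [eulerDilate_zero_gnoFibreEquiv] at he
  rw [fibreSq_gnoFibreEquiv] at h1
  exact ⟨e, he, h1, h2⟩

/-- The base density `p ↦ gnoDensity (gnoBase p)` is positive, continuous, bounded by `1`. [folklore] -/
theorem gnoDensity_gnoBase_pos_continuous :
    (∀ p : ℝ × ℝ, 0 < gnoDensity (gnoBase p.1 p.2 : GnoCoord L)) ∧ Continuous fun p : ℝ × ℝ => gnoDensity (gnoBase p.1 p.2 : GnoCoord L) :=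
  ⟨fun _ => gnoDensity_pos _, continuous_gnoDensity.comp continuous_gnoBase⟩

/-- ★ **THE TUBE CHART IDENTITY over a measurable base set `S`** — the `hchart` of ✓`laplaceMethod_quantitative_fibred_chart_cubic_offBound_on` for `μ := vol·gnoDensity` on
`GnoCoord L`, `ν := vol_{ℝ×ℝ}`, `Ψ := gnoFibreEquiv`, `J := gnoDensity ∘ gnoFibreEquiv`:
`μ|_{gnoFibreEquiv(S × B̄_R)} = (gnoFibreEquiv)_*(((vol ⊗ vol)|_{S × B̄_R})·J)`, and the tube image is measurable. [folklore] -/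
theorem volume_gnoDensity_restrict_tube_eq_map {S : Set (ℝ × ℝ)} (hS : MeasurableSet S) (R : ℝ) :
    MeasurableSet (gnoFibreEquiv '' (S ×ˢ closedBall (0 : GnoFibre L) R)) ∧
    ((volume : Measure (GnoCoord L)).withDensity (fun η => ENNReal.ofReal (gnoDensity η))).restrict (gnoFibreEquiv '' (S ×ˢ closedBall (0 : GnoFibre L) R)) =
      ((((volume : Measure (ℝ × ℝ)).prod (volume : Measure (GnoFibre L))).restrict (S ×ˢ closedBall (0 : GnoFibre L) R)).withDensity
        (fun q => ENNReal.ofReal (gnoDensity (gnoFibreEquiv q)))).map (gnoFibreEquiv (L := L)) :=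
  QuantitativeLaplace.restrict_image_eq_map_of_measurableEquiv (κ := (volume : Measure (ℝ × ℝ)).prod (volume : Measure (GnoFibre L))) (gnoFibreEquiv (L := L))
    (volume_withDensity_eq_map_gnoFibreEquiv (ENNReal.measurable_ofReal.comp measurable_gnoDensity)) (hS.prod measurableSet_closedBall)

/-- The density measure `vol·gnoDensity` on `GnoCoord L` is finite (✓`integrable_gnoDensity`). [folklore] -/
theorem isFiniteMeasure_volume_gnoDensity : IsFiniteMeasure ((volume : Measure (GnoCoord L)).withDensity fun η => ENNReal.ofReal (gnoDensity η)) :=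
  isFiniteMeasure_withDensity_ofReal (integrable_gnoDensity (L := L)).2

/-! ## §5 The bulk sockets, packaged -/

/-- ★★★ **THE BULK SOCKETS OF THE GNOMONIC FIBRE, principal sector** (`ε_z = +`, followers `+`, hub `a ≠ 0`): Hessian operators `A p` at the base points `gnoBase p`, the cubic
remainder `ρ` and the amplitude defect `e`, with — symmetry; measurability of `(p,y) ↦ ⟪A p y, y⟫`, of `ρ`, of `e`; the ray identity; `|⟪A p y, y⟫| ≤ 20400L⁴‖y‖²`;
`F̂(gnoFibreEquiv (p, y)) − 0 = ½⟪A p y, y⟫ + ρ (p, y)` with `|ρ (p, y)| ≤ 414000L⁴‖y‖³` (all `y`); `gnoDensity (gnoFibreEquiv (p,y)) · 1 = gnoDensity (gnoBase p) · (1 + e (p, y))` with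
`|e (p, y)| ≤ (2R)·‖y‖` for `‖y‖ ≤ R` (any `R ≥ 0`); coercivity `μ′‖y‖² ≤ ⟪A p y, y⟫` at every `p = (x₀, y₀)` for every `0 < μ′` below the four growth constants.  These are the
`hA hAm hρ_meas hη_meas hf hρ hw hcoer` of ✓`laplaceMethod_quantitative_fibred_chart_cubic_offBound_on` (`f := F̂`, `f₀ := 0`, `Ψ := gnoFibreEquiv`, `J := gnoDensity ∘ gnoFibreEquiv`,
`φ := 1` on the bulk cylinder, `A₃ := 414000L⁴`, `D := 2R`). [cite: Luscher1983, §2] [cite: HasenpflugRudolfSprungk2024, §3.1 Assumption 2] -/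
theorem gnoFibre_bulk_sockets {a : ℍ} (ha : a ≠ 0) (ε : GnoSign L) (hz : ε.2.1 = true) (hε : ε.2.2 = fun _ => true) :
    ∃ A : ℝ × ℝ → GnoFibre L →ₗ[ℝ] GnoFibre L, ∃ ρ e : (ℝ × ℝ) × GnoFibre L → ℝ,
      (∀ p, (A p).IsSymmetric) ∧
      (Measurable fun q : (ℝ × ℝ) × GnoFibre L => ⟪A q.1 q.2, q.2⟫_ℝ) ∧ Measurable ρ ∧ Measurable e ∧
      (∀ p (y : GnoFibre L), ⟪A p y, y⟫_ℝ = iteratedDeriv 2 (fun s : ℝ => gnoDeficit (fun _ => false) (fun _ => 1) a ε (gnoBase p.1 p.2 + s • gnoFibreEmb y)) 0) ∧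
      (∀ p (y : GnoFibre L), |⟪A p y, y⟫_ℝ| ≤ 20400 * (L : ℝ) ^ 4 * ‖y‖ ^ 2) ∧
      (∀ p (y : GnoFibre L), gnoDeficit (fun _ => false) (fun _ => 1) a ε (gnoFibreEquiv (p, y)) - 0 = (1 / 2) * ⟪A p y, y⟫_ℝ + ρ (p, y)) ∧
      (∀ p (y : GnoFibre L), |ρ (p, y)| ≤ 414000 * (L : ℝ) ^ 4 * ‖y‖ ^ 3) ∧
      (∀ p (y : GnoFibre L), gnoDensity (gnoFibreEquiv (p, y)) * 1 = gnoDensity (gnoBase p.1 p.2 : GnoCoord L) * (1 + e (p, y))) ∧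
      (∀ R : ℝ, 0 ≤ R → ∀ p (y : GnoFibre L), ‖y‖ ≤ R → |e (p, y)| ≤ (2 * R) * ‖y‖) ∧
      (∀ (x₀ y₀ μ' : ℝ), 0 < μ' →
        μ' ≤ 2 * (2 * (‖a‖⁻¹ * a.re) * (‖a‖⁻¹ * ‖a.im‖)) ^ 2 / ((2 + x₀ ^ 2) * (16200 * (L : ℝ) ^ 6)) →
        μ' ≤ 2 * (‖a‖⁻¹ * ‖a.im‖) ^ 2 / ((2 + y₀ ^ 2) * (16200 * (L : ℝ) ^ 6)) →
        μ' ≤ 1 / (16200 * (L : ℝ) ^ 6) → μ' ≤ (2304 * (L : ℝ) ^ 6 * (Fintype.card (Fol L) : ℝ))⁻¹ / 2 →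
        ∀ y : GnoFibre L, μ' * ‖y‖ ^ 2 ≤ ⟪A (x₀, y₀) y, y⟫_ℝ) := by
  obtain ⟨A, hAs, -, hAyy, hray, hAm, hAbd, -⟩ := exists_gnoFibreHessian (fun _ => false) (fun _ => 1) ha ε
  -- measurability of the base-indexed form: compose the `η`-indexed one with the (measurable) base point
  have hbase : Measurable fun p : ℝ × ℝ => (gnoBase p.1 p.2 : GnoCoord L) := by
    have h := (measurable_gnoFibreEquiv (L := L)).comp (measurable_id.prodMk (measurable_const (a := (0 : GnoFibre L))))
    have e : (fun p : ℝ × ℝ => (gnoBase p.1 p.2 : GnoCoord L)) = fun p => gnoFibreEquiv (p, (0 : GnoFibre L)) :=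
      funext fun p => by rw [gnoFibreEquiv_apply, map_zero, add_zero]
    rw [e]; exact h
  have hG : Measurable fun q : (ℝ × ℝ) × GnoFibre L => ((gnoBase q.1.1 q.1.2 : GnoCoord L), q.2) := (hbase.comp measurable_fst).prodMk measurable_snd
  have hAbm : Measurable fun q : (ℝ × ℝ) × GnoFibre L => ⟪A (gnoBase q.1.1 q.1.2) q.2, q.2⟫_ℝ := by
    -- (elaborated WITHOUT expected type: `hAm.comp hG` against the target makes `isDefEq` time out)
    have h := Measurable.comp hAm hG
    exact h
  have hFm : Measurable fun q : (ℝ × ℝ) × GnoFibre L => gnoDeficit (fun _ => false) (fun _ => 1) a ε (gnoFibreEquiv q) :=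
    (measurable_gnoDeficit _ _ a ε).comp measurable_gnoFibreEquiv
  have hdm : Measurable fun q : (ℝ × ℝ) × GnoFibre L => gnoDensity (gnoBase q.1.1 q.1.2 : GnoCoord L) :=
    (gnoDensity_gnoBase_pos_continuous (L := L)).2.measurable.comp measurable_fst
  have hρm : Measurable fun q : (ℝ × ℝ) × GnoFibre L =>
      gnoDeficit (fun _ => false) (fun _ => 1) a ε (gnoFibreEquiv q) - (1 / 2) * ⟪A (gnoBase q.1.1 q.1.2) q.2, q.2⟫_ℝ :=
    hFm.sub (measurable_const.mul hAbm)
  have hem : Measurable fun q : (ℝ × ℝ) × GnoFibre L => gnoDensity (gnoFibreEquiv q) / gnoDensity (gnoBase q.1.1 q.1.2 : GnoCoord L) - 1 :=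
    ((measurable_gnoDensity.comp measurable_gnoFibreEquiv).div hdm).sub measurable_const
  refine ⟨fun p => A (gnoBase p.1 p.2),
    fun q => gnoDeficit (fun _ => false) (fun _ => 1) a ε (gnoFibreEquiv q) - (1 / 2) * ⟪A (gnoBase q.1.1 q.1.2) q.2, q.2⟫_ℝ,
    fun q => gnoDensity (gnoFibreEquiv q) / gnoDensity (gnoBase q.1.1 q.1.2 : GnoCoord L) - 1,
    fun p => hAs _, hAbm, hρm, hem, fun p y => hray _ y, fun p y => hAbd _ y, fun p y => ?_, fun p y => ?_, fun p y => ?_, fun R hR p y hy => ?_,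
    fun x₀ y₀ μ' hμ hμx hμy hμz hμF y => ?_⟩
  · -- `hf`: an identity
    dsimp only
    ring
  · -- `hρ`: the cubic datum at the flat base
    dsimp only
    rw [gnoFibreEquiv_apply]
    exact gnoFibreHessian_base_cubic ha ε hz hε hAyy p.1 p.2 y
  · -- `hw`: an identity (`φ = 1` on the cylinder)
    dsimp only
    have h0 : gnoDensity (gnoBase p.1 p.2 : GnoCoord L) ≠ 0 := (gnoDensity_pos _).ne'
    field_simp
    ring
  · -- `hη`: the amplitude defect
    dsimp only
    obtain ⟨e', he', h1, h2⟩ := gnoDensity_fibre_amplitude p y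
    have h0 : 0 < gnoDensity (gnoBase p.1 p.2 : GnoCoord L) := gnoDensity_pos _
    have hee : gnoDensity (gnoFibreEquiv (p, y)) / gnoDensity (gnoBase p.1 p.2 : GnoCoord L) - 1 = e' := by
      rw [he', mul_div_cancel_left₀ _ h0.ne']; ring
    rw [hee, abs_le]
    constructor
    · have : 2 * ‖y‖ ^ 2 ≤ 2 * R * ‖y‖ := by nlinarith [norm_nonneg y]
      linarith
    · have : 0 ≤ 2 * R * ‖y‖ := by positivity
      linarith
  · -- `hcoer` at the base point `(x₀, y₀)`
    exact gnoFibreHessian_base_coercive ha ε hz hε hray x₀ y₀ hμ hμx hμy hμz hμF y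

end Summit.QuantumFields.YangMills.Theorems.SwapVirialDeficit.BlowUpRing

end
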